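import Summits.BirchSwinnertonDyer.BirchSwinnertonDyer.Theorems.EisensteinPrimesSelmerAcQuotientCorankOfLoc
import Summits.BirchSwinnertonDyer.BirchSwinnertonDyer.Theorems.EisensteinPrimesSelmerAcSplitMultiplicativePlace
import Summits.BirchSwinnertonDyer.BirchSwinnertonDyer.Theorems.EisensteinPrimesSelmerAcMultiplicativePlaceSign
import Summits.BirchSwinnertonDyer.BirchSwinnertonDyer.Theorems.EisensteinPrimesSqrtGammaUnramifiedSign
import Summits.BirchSwinnertonDyer.BirchSwinnertonDyer.Theorems.EisensteinPrimesUnrSelmerQuotientTorsionFiniteChar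
import Summits.BirchSwinnertonDyer.BirchSwinnertonDyer.Theorems.EisensteinPrimesNumPlacesAboveRepresentatives
import Summits.BirchSwinnertonDyer.Rank1Residual.AdditivePotMult.QuadraticBaseChangeOddTamagawaAdditiveAll
import Summits.BirchSwinnertonDyer.Rank1Residual.X2.GreenbergVatsalTateFrobeniusSign
import Summits.BirchSwinnertonDyer.Rank1Residual.X2.NonPrimitiveLambdaShiftRat
import Literature.NumberTheory.DiophantineGeometry.KodairaSymbolUnramifiedBaseChangeProofs
import Literature.NumberTheory.DiophantineGeometry.TateAlgorithmProofs
import Literature.NumberTheory.DiophantineGeometry.TateAlgorithmAdditiveProofs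
import Literature.NumberTheory.EllipticCurves.ArtinFormalismSemistableLocalProofs
import Literature.NumberTheory.EllipticCurves.HasseWeilAbelianBadReduction
import Literature.NumberTheory.EllipticCurves.PAdicBSDSplitMultiplicativeProofs
import Literature.NumberTheory.EllipticCurves.RootNumberTwistProofs
import Literature.NumberTheory.EllipticCurves.ModularityVersionApProofs
import Literature.NumberTheory.GaloisRepresentations.FrobeniusDensityTheorem
import Literature.NumberTheory.GaloisRepresentations.DegreeOnePlacesProofs
import Literature.NumberTheory.EllipticCurves.KellerYin2024.AnomalousImprimitiveLambdaInvariants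
import Literature.NumberTheory.EllipticCurves.TateCurve.NumberFieldUniformization
import Literature.NumberTheory.EllipticCurves.TateCurve.NumberFieldUniformizationTwisted
import HarnessLib

/-!
# The `f`-side `≤`-half of `rem142_goodLattice_selmerAc_imprimitive`, FINAL SUM:
# `corank_{ℤ_p}(Sel^{Sf}/Sel) ≤ Σ_{w ∈ Sf} λ(𝒫_w(f))` for `E ×_ℚ K` over the anticyclotomic tower

Cell `bsd-eis` (home `run/shared/lean/pub/bsd-eis/`), seat `bsd-line-x1-p1-w2` (D-0154 width seat on
crux 2 `GoodLatticeBDPValue` = stmt-BirchSwinnertonDyer-19032, line `halves`, stub `stub_imprimCorank`,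
`f`-side conjunct `rem142_goodLattice_selmerAc_imprimitive`; host RULING L110: the final sum is this
seat's).  Assembly of the chain p610683 → p611526 → p612280 (`zpCorank_selmerAc_quotient_le_sum_of_loc`:
`≤ Σ numPlacesAbove κ w · c_w` for any inertia-level per-place bound `c_w`) with the per-place bounds
`c_w = rootMultiplicity((Nw)⁻¹, P̃_w)` now in the kernel at every Heegner place `w ∣ ℓ ‖ N_E` of `K`:

* `E` additive at `ℓ` ⇒ `E_K` additive at `w` (unramified base change, Tate's algorithm A233
  `kodairaSymbolAt_baseChange_of_ramificationIdx_eq_one_holds`) ⇒ `c_w = 0` (p612280 §2);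
* `E` split multiplicative at `ℓ` ⇒ `P_w(E_K) = 1 − X` (`localPolynomialAt_baseChange_of_hasMultiplicativeReductionAt`)
  ⇒ `E_K` split at `w` ⇒ `c_w ≤ 𝟙[Nw ≡ 1]` (p613424, untwisted Tate datum `hT`);
* `E` non-split multiplicative at an ODD `ℓ` ⇒ `γ = −c₄/c₆` with `c₄, c₆ ∈ ℤ` prime to `ℓ`, inertia fixes
  `√γ` and a Frobenius flips it (p614930, Euler's criterion via X2
  `int_dvd_pow_div_two_add_one_of_not_split`, `Nw = ℓ`) ⇒ `c_w ≤ 𝟙[Nw ≡ −1]` (p614431, twisted datum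
  `hT'`), and `P_w(E_K) = 1 + X`.

In each case `numPlacesAbove κ w · c_w` is `curveLocalLambda κ E_K w` on the nose, so the sum is
`Σ_{w∈Sf} curveLocalLambda κ (E ×_ℚ K) w` — the right-hand side of `rem142` verbatim.

Tate's `v`-adic uniformisation, untwisted and twisted (Silverman *ATAEC* V.3.1, V.5.2–5.4), is taken
from the tree's PROVED `TateCurve.Silverman1994_thmV53_tateUniformisation_holds` /
`…corV54…_holds` — no named fact is assumed.  ONE HYPOTHESIS beyond rem142's binders: `h2` — `E` is not
NON-split multiplicative at `2` (the one local case treated here through `c₄, c₆ ∈ ℤ` and Euler's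
criterion at an ODD `ℓ`; removable by the `K_w`-intrinsic route — tree
`TateCurve.toAlgEquiv_eq_of_mem_inertia_of_sq_eq_gamma` + "a point fixed by inertia and one Frobenius
is rational" + `hasSplitMultiplicativeReductionAt_of_isSquare_gamma` — left to the sequel; vacuous for
odd `N_E` and for `E` split or additive at `2`).  `hpN : p ∤ N_E` is rem142's `Good W p` read through
`dvd_conductorNorm_iff`.

* `intCast_notMem_of_not_dvd`, `natCast_natGenerator_under_mem`, `absNorm_eq_natGenerator_of_heegner`,
  `natGenerator_under_dvd_of_mem` — a Heegner place `w ∋ N` and the prime `ℓ` below it (`Nw = ℓ ∣ N`);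
* `hasAdditiveReductionAt_baseChange_of_heegner`, `hasMultiplicativeReductionAt_baseChange_of_heegner` —
  the reduction type of `E_K` at `w` from that of `E` at `ℓ` (`e(w|ℓ) = 1`);
* `zpCorank_selmerAc_quotient_le_sum_curveLocalLambda` — the final sum.

HONEST FRAMING: tool theorems (no definition, no named fact introduced or assumed, no `sorry`); this
is the `≤`-half of the `f`-side conjunct UNCONDITIONALLY up to the side condition `h2`; the `≥`-half (Pollack–Weston A.2 surjectivity / Poitou–Tate) is not claimed;
closes nothing by itself (`--supports stmt-BirchSwinnertonDyer-19032`); BSD / Mazur's main conjecture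
is proved for no curve.

References: Greenberg–Vatsal 2000 §2 Prop. (2.4), Cor. (2.3); Silverman *ATAEC* V.3.1, V.5.2–5.4, Ex.
5.11; Silverman *AEC* VII.5.1, VII.5.4, C.16; Castella–Grossi–Lee–Skinner 2022 L893–901; Keller–Yin
§1.5 (L1337–1341), Rem. 1.4.2; Gross 1991 §1 (Heegner hypothesis).
-/

-- `Summit.BirchSwinnertonDyer.BirchSwinnertonDyer.…`: summit and sub-problem share a name (D-0017 layout).
set_option linter.dupNamespace false
set_option autoImplicit false

noncomputable section

open scoped Classical AddSubgroup

open CategoryTheory Function NumberField IsDedekindDomain Field ValuativeRel Polynomial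
open Literature.NumberTheory.EllipticCurves Literature.NumberTheory.EllipticCurves.GreenbergSelmer
  Literature.NumberTheory.EllipticCurves.Castella2018 Literature.NumberTheory.QuadraticFields
  Literature.NumberTheory.GaloisRepresentations Literature.NumberTheory.DiophantineGeometry
  Literature.NumberTheory.GaloisRepresentations.IsNonarchimedeanLocalField
  IsDedekindDomain.HeightOneSpectrum Rat.HeightOneSpectrum
  Summit.BirchSwinnertonDyer.Rank1Residual Summit.BirchSwinnertonDyer.Rank1Residual.X2
  Summit.BirchSwinnertonDyer.Rank1Residual.X2.NonPrimitiveQuotientCorank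
open WeierstrassCurve (integralModelInt)

namespace Summit.BirchSwinnertonDyer.BirchSwinnertonDyer.Theorems.SelmerAcQuotientCorankLeCurveLocalLambda

variable {K : Type} [Field K] [NumberField K]

/-! ## §1 A Heegner place `w ∋ N` and the prime `ℓ` below it -/

omit [NumberField K] in
/-- An integer prime to `ℓ` lies outside every place `w ∋ ℓ` (Bézout: `aℓ + bn = 1`). [folklore] -/
theorem intCast_notMem_of_not_dvd {w : HeightOneSpectrum (𝓞 K)} {ℓ : ℕ} (hℓ : ℓ.Prime)
    (hℓw : (ℓ : 𝓞 K) ∈ w.asIdeal) {n : ℤ} (hn : ¬ (ℓ : ℤ) ∣ n) : (n : 𝓞 K) ∉ w.asIdeal := by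
  intro hmem
  have hcop : IsCoprime (ℓ : ℤ) n :=
    (Prime.coprime_iff_not_dvd (Nat.prime_iff_prime_int.mp hℓ)).mpr hn
  obtain ⟨a, b, hab⟩ := hcop
  apply w.isPrime.ne_top
  rw [Ideal.eq_top_iff_one]
  have h1 : ((a * ℓ + b * n : ℤ) : 𝓞 K) = 1 := by rw [hab, Int.cast_one]
  rw [← h1]
  push_cast
  exact w.asIdeal.add_mem (w.asIdeal.mul_mem_left _ hℓw) (w.asIdeal.mul_mem_left _ hmem)

/-- The prime `ℓ` of `ℚ` below `w` lies in `w`. [folklore] -/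
theorem natCast_natGenerator_under_mem (w : HeightOneSpectrum (𝓞 K)) :
    ((natGenerator (w.under (𝓞 ℚ)) : ℕ) : 𝓞 K) ∈ w.asIdeal := by
  have h : algebraMap (𝓞 ℚ) (𝓞 K) ((natGenerator (w.under (𝓞 ℚ)) : 𝓞 ℚ)) ∈ w.asIdeal := by
    rw [← Ideal.mem_comap]
    exact natCast_natGenerator_mem (w.under (𝓞 ℚ))
  rwa [map_natCast] at h

/-- **`Nw = ℓ` at a Heegner place**: for `K` imaginary quadratic with (Heeg) for `N` and `w ∋ N`,
`f(w|ℚ) = 1` (`ramificationIdx_inertiaDeg_eq_one_of_heegner`), so `Nw = N(ℓ)^f = ℓ`.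
[cite: GrossLMS1991, §1 (p. 235) (Heegner hypothesis)] -/
theorem absNorm_eq_natGenerator_of_heegner (hK : IsImaginaryQuadratic K) {N : ℕ}
    (hH : SatisfiesHeegnerHypothesis N K) (w : HeightOneSpectrum (𝓞 K))
    (hw : ((N : ℤ) : 𝓞 K) ∈ w.asIdeal) :
    w.asIdeal.absNorm = natGenerator (w.under (𝓞 ℚ)) := by
  obtain ⟨-, hf⟩ := UnrSelmerQuotientTorsionFiniteChar.ramificationIdx_inertiaDeg_eq_one_of_heegner hK hH w hw
  have h := absNorm_under_pow_inertiaDeg (M := ℚ) w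
  rw [hf, pow_one, Rat.absNorm_asIdeal_eq_natGenerator'] at h
  exact h.symm

/-- The prime `ℓ` below a place `w ∋ N` divides `N` (else `gcd(ℓ, N) = 1 ∈ w`). [folklore] -/
theorem natGenerator_under_dvd_of_mem {N : ℕ} (w : HeightOneSpectrum (𝓞 K))
    (hw : ((N : ℤ) : 𝓞 K) ∈ w.asIdeal) : natGenerator (w.under (𝓞 ℚ)) ∣ N := by
  by_contra hnd
  have hℓp : (natGenerator (w.under (𝓞 ℚ))).Prime := prime_natGenerator _
  have hnd' : ¬ (natGenerator (w.under (𝓞 ℚ)) : ℤ) ∣ (N : ℤ) := by rwa [Int.natCast_dvd_natCast]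
  exact intCast_notMem_of_not_dvd hℓp (natCast_natGenerator_under_mem w) hnd' hw

/-! ## §2 The reduction type of `E ×_ℚ K` at a Heegner place from that of `E` at `ℓ` -/

/-- **Additive reduction persists at a Heegner place** (`e(w|ℓ) = 1`; Tate's algorithm under unramified
base change, tree theorem `kodairaSymbolAt_baseChange_of_ramificationIdx_eq_one_holds`, via
`AdditivePotMult.hasAdditiveReductionAt_baseChange_of_unramifiedFact`).
[cite: SilvermanAEC2009, Prop. VII.5.4 (a) with proof (p. 197)] -/
theorem hasAdditiveReductionAt_baseChange_of_heegner (W : WeierstrassCurve ℚ) [W.IsElliptic]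
    (hK : IsImaginaryQuadratic K) {N : ℕ} (hH : SatisfiesHeegnerHypothesis N K)
    (w : HeightOneSpectrum (𝓞 K)) (hw : ((N : ℤ) : 𝓞 K) ∈ w.asIdeal)
    (hadd : W.HasAdditiveReductionAt (w.under (𝓞 ℚ))) : (W.baseChange K).HasAdditiveReductionAt w := by
  obtain ⟨he, -⟩ := UnrSelmerQuotientTorsionFiniteChar.ramificationIdx_inertiaDeg_eq_one_of_heegner hK hH w hw
  exact AdditivePotMult.hasAdditiveReductionAt_baseChange_of_unramifiedFact W
    (UnramifiedBaseChange.kodairaSymbolAt_baseChange_of_ramificationIdx_eq_one_holds K (w.under (𝓞 ℚ)) w W)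
    rfl he hadd

/-- **Multiplicative reduction persists at a Heegner place**: if `E` is neither good nor additive at the
prime `ℓ` below `w` (`e(w|ℓ) = 1`), then `E_K` is multiplicative at `w` — the Kodaira symbols of `E` at
`ℓ` and of `E_K` at `w` agree (`kodairaSymbolAt_baseChange_eq` with the proved fact A233), good / additive
reduction are read off the symbol (`isGood_kodairaSymbolAt_iff_holds`, `isAdditive_kodairaSymbolAt_iff_holds`),
and the local minimal model at `w` is good, multiplicative or additive.
[cite: SilvermanAEC2009, Prop. VII.5.4 (a) with proof (p. 197)] [cite: SilvermanAEC2009, VII.5 Prop. 5.1] -/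
theorem hasMultiplicativeReductionAt_baseChange_of_heegner (W : WeierstrassCurve ℚ) [W.IsElliptic]
    (hK : IsImaginaryQuadratic K) {N : ℕ} (hH : SatisfiesHeegnerHypothesis N K)
    (w : HeightOneSpectrum (𝓞 K)) (hw : ((N : ℤ) : 𝓞 K) ∈ w.asIdeal)
    (hbad : ¬ W.HasGoodReductionAt (w.under (𝓞 ℚ)))
    (hna : ¬ W.HasAdditiveReductionAt (w.under (𝓞 ℚ))) :
    (W.baseChange K).HasMultiplicativeReductionAt w := by
  obtain ⟨he, -⟩ := UnrSelmerQuotientTorsionFiniteChar.ramificationIdx_inertiaDeg_eq_one_of_heegner hK hH w hw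
  haveI : Finite (IsLocalRing.ResidueField ((w.under (𝓞 ℚ)).adicCompletionIntegers ℚ)) :=
    AdditivePotMult.finite_residueField_adicCompletionIntegers_rat (w.under (𝓞 ℚ))
  haveI : PerfectField (IsLocalRing.ResidueField ((w.under (𝓞 ℚ)).adicCompletionIntegers ℚ)) :=
    PerfectField.ofFinite
  haveI : Finite (IsLocalRing.ResidueField (w.adicCompletionIntegers K)) :=
    HeightOneSpectrum.finite_residueField_adicCompletionIntegers K w
  haveI : PerfectField (IsLocalRing.ResidueField (w.adicCompletionIntegers K)) := PerfectField.ofFinite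
  haveI : (W.baseChange K).IsElliptic := by rw [WeierstrassCurve.baseChange]; infer_instance
  have hc : (algebraMap ℚ K).comp (algebraMap (𝓞 ℚ) ℚ) =
      (algebraMap (𝓞 K) K).comp (algebraMap (𝓞 ℚ) (𝓞 K)) := by
    rw [← IsScalarTower.algebraMap_eq, ← IsScalarTower.algebraMap_eq]
  have hwv : w.asIdeal.under (𝓞 ℚ) = (w.under (𝓞 ℚ)).asIdeal := rfl
  have hk : (W.baseChange K).kodairaSymbolAt w = W.kodairaSymbolAt (w.under (𝓞 ℚ)) :=
    kodairaSymbolAt_baseChange_eq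
      (UnramifiedBaseChange.kodairaSymbolAt_baseChange_of_ramificationIdx_eq_one_holds K (w.under (𝓞 ℚ)) w W)
      hc hwv (AdditivePotMult.not_map_le_sq_of_ramificationIdx_eq_one rfl he)
  have hngK : ¬ (W.baseChange K).HasGoodReductionAt w := fun hg ↦ hbad
    ((WeierstrassCurve.isGood_kodairaSymbolAt_iff_holds (w.under (𝓞 ℚ)) W).mp
      (hk ▸ (WeierstrassCurve.isGood_kodairaSymbolAt_iff_holds w (W.baseChange K)).mpr hg))
  have hnaK : ¬ (W.baseChange K).HasAdditiveReductionAt w := fun ha ↦ hna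
    ((WeierstrassCurve.isAdditive_kodairaSymbolAt_iff_holds (w.under (𝓞 ℚ)) W).mp
      (hk ▸ (WeierstrassCurve.isAdditive_kodairaSymbolAt_iff_holds w (W.baseChange K)).mpr ha))
  rcases WeierstrassCurve.hasGoodReduction_or_hasMultiplicativeReduction_or_hasAdditiveReduction
    (w.adicCompletionIntegers K) (W := (W.baseChange K).localMinimalModel w) with h | h | h
  · exact absurd h hngK
  · exact h
  · exact absurd h hnaK

/-! ## §3 The final sum -/

/-- **The `f`-side `≤`-half of KY Remark 1.4.2 / CGLS (eq:1) for `E ×_ℚ K`, FINAL SUM.**  For a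
globally minimal elliptic `E/ℚ`, an odd prime `p ∤ N_E`, `K` imaginary quadratic with the Heegner
hypothesis for `N_E`, an anticyclotomic `ℤ_p`-extension `κ` with topological generator `γ`, any `𝔭` and
`Sf` = the places of `K` above `N_E`:
`corank_{ℤ_p}(Sel_𝔭^{Sf}(E_K/K_∞) / Sel_𝔭(E_K/K_∞)) ≤ Σ_{w∈Sf} curveLocalLambda κ E_K w`
— granted only that `E` is not non-split multiplicative at `2` (`h2`); Tate's uniformisation is the
tree's proved `…tateUniformisation_holds`.  Proof: `zpCorank_selmerAc_quotient_le_sum_of_loc` (p612280) with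
`c_w = rootMultiplicity((Nw)⁻¹, P̃_w(E_K))`, the per-place bounds being supplied by the trichotomy of
`E` at the prime `ℓ = Nw` below `w` (§2): additive ⇒ `0` (p612280 §2); split ⇒ `E_K` split at `w`
(`P_w = 1 − X`) and p613424; non-split (`ℓ` odd by `h2`) ⇒ p614431 with the local inputs of p614930 fed by
`c₄, c₆ ∈ ℤ` of the minimal model (`ℓ`-units, Silverman VII.5.1 (b)) and Euler's criterion
(X2 `int_dvd_pow_div_two_add_one_of_not_split`), and `P_w = 1 + X`.  The `≥`-half (Pollack–Weston
A.2) is NOT claimed. [cite: GreenbergVatsal2000, §2 Prop. (2.4) pp. 22–23 and Cor. (2.3)]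
[cite: KellerYin2024, Rem. 1.4.2 (surj for Self; arXiv:2402.12781v2 TeX L1130–1140) and §1.5 (L1337–1341)]
[cite: CastellaGrossiLeeSkinner2022, (eq:1) (arXiv:2008.02571v2 TeX L882–884), L893–901 (𝒫_w(E))]
[cite: SilvermanATAEC1994, Ch. V Lemma 5.2 (c), Thm. 5.3 (a),(b), Cor. 5.4 (held copy PDF pp. 406–410)]
[cite: SilvermanAEC2009, VII.5 Prop. 5.1(b), Prop. VII.5.4 and §C.16] -/
theorem zpCorank_selmerAc_quotient_le_sum_curveLocalLambda
    (W : WeierstrassCurve ℚ) [W.IsElliptic] [W.IsGloballyMinimal]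
    (h2 : ∀ u : HeightOneSpectrum (𝓞 ℚ), ((2 : ℕ) : 𝓞 ℚ) ∈ u.asIdeal →
      W.HasMultiplicativeReductionAt u → W.HasSplitMultiplicativeReductionAt u)
    {p : ℕ} [Fact p.Prime] (hp2 : 2 < p) (hpN : ¬ p ∣ W.conductorNorm ℤ)
    (hK : IsImaginaryQuadratic K) (hH : SatisfiesHeegnerHypothesis (W.conductorNorm ℤ) K)
    (κ : ZpExtension K p) (hκ : κ.IsAnticyclotomic) {γ : absoluteGaloisGroup K}
    (hγ : κ.IsTopGenerator γ) (𝔭 : HeightOneSpectrum (𝓞 K)) (Sf : Finset (HeightOneSpectrum (𝓞 K)))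
    (hSf : ∀ w : HeightOneSpectrum (𝓞 K), w ∈ Sf ↔ ((W.conductorNorm ℤ : ℤ) : 𝓞 K) ∈ w.asIdeal) :
    zpCorank (↥(AcSelmer.selmerAc (W.baseChange K) p κ 𝔭 (↑Sf : Set (HeightOneSpectrum (𝓞 K)))) ⧸
        (AcSelmer.selmerAc (W.baseChange K) p κ 𝔭 (∅ : Set (HeightOneSpectrum (𝓞 K)))).addSubgroupOf
          (AcSelmer.selmerAc (W.baseChange K) p κ 𝔭 (↑Sf : Set (HeightOneSpectrum (𝓞 K))))) p ≤
      ∑ w ∈ Sf, KellerYin2024.curveLocalLambda κ (W.baseChange K) w := by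
  haveI : (W.baseChange K).IsElliptic := by rw [WeierstrassCurve.baseChange]; infer_instance
  -- Tate's `v`-adic uniformisation, untwisted and twisted: PROVED in the tree
  have hT : Silverman1994_thmV53_tateUniformisation.{0} :=
    TateCurve.Silverman1994_thmV53_tateUniformisation_holds
  have hT' : Silverman1994_thmV53_corV54_tateUniformisation.{0} :=
    TateCurve.Silverman1994_thmV53_corV54_tateUniformisation_holds
  have hp2' : p ≠ 2 := by omega
  have hp : p.Prime := Fact.out
  refine SelmerAcQuotientCorankOfLoc.zpCorank_selmerAc_quotient_le_sum_of_loc hK hp2 hH hpN κ hκ hγ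
    (W.baseChange K) 𝔭 Sf hSf
    (fun w ↦ (GreenbergVatsal2000.eulerFactorModP (W.baseChange K) p w).rootMultiplicity
      ((w.asIdeal.absNorm : ZMod p)⁻¹)) ?_
  intro w hw Y hY
  -- the place `w ∋ N_E`, the prime `ℓ = Nw` below it
  have hwN : ((W.conductorNorm ℤ : ℤ) : 𝓞 K) ∈ w.asIdeal := (hSf w).mp hw
  set u := w.under (𝓞 ℚ) with hu
  set ℓ := natGenerator u with hℓ
  have hℓprime : ℓ.Prime := prime_natGenerator u
  haveI hℓfact : Fact ℓ.Prime := ⟨hℓprime⟩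
  obtain ⟨-, hf⟩ := UnrSelmerQuotientTorsionFiniteChar.ramificationIdx_inertiaDeg_eq_one_of_heegner hK hH w hwN
  have hℓw : (ℓ : 𝓞 K) ∈ w.asIdeal := natCast_natGenerator_under_mem w
  have hℓu : ((ℓ : ℕ) : 𝓞 ℚ) ∈ u.asIdeal := natCast_natGenerator_mem u
  have hNw : w.asIdeal.absNorm = ℓ := absNorm_eq_natGenerator_of_heegner hK hH w hwN
  have hℓN : ℓ ∣ W.conductorNorm ℤ := natGenerator_under_dvd_of_mem w hwN
  have hℓp : ℓ ≠ p := fun h ↦ hpN (h ▸ hℓN)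
  have hpw : ((p : ℕ) : 𝓞 K) ∉ w.asIdeal := by
    have hnd : ¬ (ℓ : ℤ) ∣ (p : ℤ) := by
      intro h
      have h' : ℓ ∣ p := by exact_mod_cast h
      exact hℓp ((Nat.prime_dvd_prime_iff_eq hℓprime hp).mp h')
    have h := intCast_notMem_of_not_dvd hℓprime hℓw hnd
    exact_mod_cast h
  have hbad : ¬ W.HasGoodReductionAt u := (W.dvd_conductorNorm_iff u).mp hℓN
  by_cases hadd : W.HasAdditiveReductionAt u
  · -- additive at `ℓ`: `E_K` additive at `w`, the local group is finite
    have haddK : (W.baseChange K).HasAdditiveReductionAt w :=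
      hasAdditiveReductionAt_baseChange_of_heegner W hK hH w hwN hadd
    rw [SelmerAcQuotientCorankOfLoc.zpCorank_eq_zero_of_hasAdditiveReductionAt (W.baseChange K)
      κ.kerSubgroup w hpw haddK (Iwasawa.inertia_le_kerSubgroup' κ w hpw) Y]
    exact Nat.zero_le _
  · -- multiplicative at `ℓ`
    have hmult : W.HasMultiplicativeReductionAt u :=
      (NonPrimitiveLambdaShiftRat.additive_or_multiplicative_of_not_hasGoodReductionAt W hbad).resolve_left hadd
    have hmultK : (W.baseChange K).HasMultiplicativeReductionAt w :=
      hasMultiplicativeReductionAt_baseChange_of_heegner W hK hH w hwN hbad hadd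
    have hD := UnrSelmerQuotientTorsionFiniteChar.exists_mem_decomp_apply_ne_one_of_heegner hK hp2 hH κ
      hκ w hwN hpw
    have hpos : 0 < KellerYin2024.numPlacesAbove κ w :=
      NumPlacesAboveRepresentatives.numPlacesAbove_pos κ w hD
    have hwv : w.asIdeal.under (𝓞 ℚ) = u.asIdeal := rfl
    by_cases hsplit : W.HasSplitMultiplicativeReductionAt u
    · -- split at `ℓ`: `P_w(E_K) = 1 - X`, so `E_K` is split at `w`
      have hPu : W.localPolynomialAt u = 1 - C (1 : ℤ) * X := by
        rw [WeierstrassCurve.localPolynomialAt_of_hasSplitMultiplicativeReductionAt hsplit, map_one, one_mul]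
      have hPw : (W.baseChange K).localPolynomialAt w = 1 - C (1 : ℤ) * X := by
        rw [W.localPolynomialAt_baseChange_of_hasMultiplicativeReductionAt K hwv hmult hPu, one_pow]
      have hsplitK : (W.baseChange K).HasSplitMultiplicativeReductionAt w := by
        by_contra hns
        have h' := WeierstrassCurve.localPolynomialAt_of_hasMultiplicativeReductionAt_of_not_hasSplitMultiplicativeReductionAt
          hmultK hns
        rw [hPw, map_one, one_mul] at h'
        have h1 := congrArg (fun P : Polynomial ℤ ↦ P.coeff 1) h'
        simp only [Polynomial.coeff_sub, Polynomial.coeff_add, Polynomial.coeff_one, Polynomial.coeff_X_one,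
          one_ne_zero, if_false] at h1
        omega
      have hb := SelmerAcSplitMultiplicativePlace.zpCorank_le_of_hasSplitMultiplicativeReductionAt hT
        (W.baseChange K) hp2' κ hpw hsplitK Y hY
      have hR := SelmerAcSplitMultiplicativePlace.curveLocalLambda_of_hasSplitMultiplicativeReductionAt
        (p := p) κ (W.baseChange K) hsplitK
      rw [KellerYin2024.curveLocalLambda_eq] at hR
      rw [Nat.eq_of_mul_eq_mul_left hpos hR]
      exact hb
    · -- non-split at `ℓ`: `ℓ` is odd (`h2`), `γ = -c₄/c₆` with `c₄, c₆ ∈ ℤ` prime to `ℓ`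
      have hℓ2 : ℓ ≠ 2 := fun h ↦ hsplit (h2 u (by rw [← h]; exact hℓu) hmult)
      have hmultℓ : W.HasMultiplicativeReductionAtPrime ℓ :=
        (W.hasMultiplicativeReductionAtPrime_iff_hasMultiplicativeReductionAt_ringOfIntegers u).2 hmult
      have hnsℓ : ¬ W.HasSplitMultiplicativeReductionAtPrime ℓ := fun h ↦
        hsplit ((W.hasSplitMultiplicativeReductionAtPrime_iff_hasSplitMultiplicativeReductionAt u).1 h)
      obtain ⟨-, hc₄⟩ := Additive.dvd_and_not_dvd_c₄_of_hasMultiplicativeReductionAtPrime W ℓ hmultℓ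
      have hc₆ := GreenbergVatsalTateDatumRat.not_dvd_c₆_of_hasMultiplicativeReductionAtPrime W hmultℓ
      have e4 : W.c₄ = ((integralModelInt W).c₄ : ℚ) := by
        conv_lhs => rw [← WeierstrassCurve.map_integralModelInt W]
        rw [WeierstrassCurve.map_c₄, eq_intCast]
      have e6 : W.c₆ = ((integralModelInt W).c₆ : ℚ) := by
        conv_lhs => rw [← WeierstrassCurve.map_integralModelInt W]
        rw [WeierstrassCurve.map_c₆, eq_intCast]
      have h4 : (W.baseChange K).c₄ = (((integralModelInt W).c₄ : ℤ) : K) := by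
        rw [WeierstrassCurve.baseChange, WeierstrassCurve.map_c₄, e4, map_intCast]
      have h6 : (W.baseChange K).c₆ = (((integralModelInt W).c₆ : ℤ) : K) := by
        rw [WeierstrassCurve.baseChange, WeierstrassCurve.map_c₆, e6, map_intCast]
      have ha : (((integralModelInt W).c₄ : ℤ) : 𝓞 K) ∉ w.asIdeal := intCast_notMem_of_not_dvd hℓprime hℓw hc₄
      have hb : (((integralModelInt W).c₆ : ℤ) : 𝓞 K) ∉ w.asIdeal := intCast_notMem_of_not_dvd hℓprime hℓw hc₆
      have h2w : (2 : 𝓞 K) ∉ w.asIdeal := by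
        have hnd : ¬ (ℓ : ℤ) ∣ (2 : ℤ) := by
          intro h
          have h' : ℓ ∣ 2 := by exact_mod_cast h
          exact hℓ2 ((Nat.prime_dvd_prime_iff_eq hℓprime Nat.prime_two).mp h')
        have h := intCast_notMem_of_not_dvd hℓprime hℓw hnd
        exact_mod_cast h
      have hodd : ¬ 2 ∣ w.asIdeal.absNorm := by
        rw [hNw]
        exact fun h ↦ hℓ2 ((Nat.prime_dvd_prime_iff_eq Nat.prime_two hℓprime).mp h).symm
      have hg : (ℓ : ℤ) ∣ (-((integralModelInt W).c₄ * (integralModelInt W).c₆)) ^ (w.asIdeal.absNorm / 2) + 1 := by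
        rw [hNw]
        exact GreenbergVatsalTateFrobeniusSign.int_dvd_pow_div_two_add_one_of_not_split W ℓ hℓ2 hmultℓ hnsℓ
      have hI := SqrtGammaUnramifiedSign.inertia_fix_sqrt_gamma_of_c₄_eq_intCast (W.baseChange K) h4 h6
        ha hb h2w
      have hF := SqrtGammaUnramifiedSign.exists_isFrobPow_one_apply_sqrt_gamma_ne_of_c₄_eq_intCast
        (W.baseChange K) h4 h6 ha hb h2w hℓw hodd hg
      have hbnd := SelmerAcMultiplicativePlaceSign.zpCorank_le_of_frob_flips_sqrt_gamma hT' (W.baseChange K)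
        hp2' κ hpw hmultK hI hF Y hY
      -- bookkeeping: `P_u = 1 + X`, so `P_w(E_K) = 1 - C(-1) X`
      have hPu : W.localPolynomialAt u = 1 - C (-1 : ℤ) * X := by
        rw [WeierstrassCurve.localPolynomialAt_of_hasMultiplicativeReductionAt_of_not_hasSplitMultiplicativeReductionAt
          hmult hsplit, map_neg, map_one, neg_one_mul, sub_neg_eq_add]
      have hPw : (W.baseChange K).localPolynomialAt w = 1 - C (-1 : ℤ) * X := by
        rw [W.localPolynomialAt_baseChange_of_hasMultiplicativeReductionAt K hwv hmult hPu, hf, pow_one]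
      have hR := SelmerAcMultiplicativePlaceSign.curveLocalLambda_of_localPolynomialAt_eq_one_sub_C_mul_X
        (p := p) κ (W.baseChange K) (Or.inr rfl) hPw
      rw [KellerYin2024.curveLocalLambda_eq] at hR
      rw [Nat.eq_of_mul_eq_mul_left hpos hR]
      simpa only [Int.cast_natCast, Int.cast_neg, Int.cast_one] using hbnd

end Summit.BirchSwinnertonDyer.BirchSwinnertonDyer.Theorems.SelmerAcQuotientCorankLeCurveLocalLambda

end
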